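import Mathlib
import Summits.ValiantsHypothesis.ValiantsHypothesis.Theses.ElementaryWordLength

/-!
# Sketch (crux-ideate, ideator 2): rank-one border continuants for `WordLengthQP`

First lemmas of the line `rank-one-border-continuant` (idea card
`Cruxes/WordLengthQP/Ideas/rank-one-border-continuant.md`), stated over existing declarations
(`Matrix.transvection`, `MvPolynomial`, `RatFunc`, `perPoly`, the route decl `WordLengthQP`).
Nothing here is proved; everything must ELABORATE.

* `TopFormFactors` — Cohn's degree argument in the E₂-letter model: every entry of a product of
  affine 2×2 transvections over `K[x̄]` (K a field) is constant or has top homogeneous component a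
  product of linear forms (Cohn 1966 Thm (2.2), Lemma (5.1), §5 Ex. 2).
* `NoExactAffineE2WordPer` — corollary: no exact affine E₂-word has an entry equal to `per_n`,
  `n ≥ 2` (the Allender–Wang phenomenon in the transvection model).
* `BorderQWordQP` — the transfer target C⁺⁺ (junk-free, integral border Q-words of BIZ18 Prop 3.5):
  no quasi-polynomial product of primitive Q-matrices `Q(a) = [[a,1],[1,0]]`, `a ∈ ℂ(ε) ∪ {x_ij}`,
  equals `Q(per_n)` modulo `ε · Mat₂(ℂ[ε][x̄])`.
* `Transfer` — `BorderQWordQP → WordLengthQP` (BIZ18 Prop 3.5 + Brent + the route's `WordToFormula`).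
* `BorderOvershoot` — first border rung: flattenings force `C(n,⌊n/2⌋)² ≤ 2^length`.
-/

namespace Summit.ValiantsHypothesis.ValiantsHypothesis.Cruxes.WordLengthQP.RankOneBorderContinuant

open Literature.Computability.AlgebraicComplexity

/-- Cohn's top-form rigidity in the E₂-letter model (exact, any field of coefficients):
for every word of affine elementary 2×2 matrices `E_ij(c)` / `E_ij(c·x_v)` over `K[x̄]`, every entry
of the product is a constant or its top-degree homogeneous component is a product of linear forms. -/
def TopFormFactors : Prop :=
  ∀ (K : Type) [Field K] (σ : Type) (w : List (Fin 2 × Fin 2 × K × Option σ)),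
    (∀ l ∈ w, l.1 ≠ l.2.1) →
    ∀ i j : Fin 2,
      ((w.map (fun l => Matrix.transvection l.1 l.2.1
          (MvPolynomial.C l.2.2.1 * l.2.2.2.elim 1 MvPolynomial.X))).prod i j).totalDegree = 0 ∨
      ∃ (m : ℕ) (ℓ : Fin m → MvPolynomial σ K),
        (∀ t, (ℓ t).IsHomogeneous 1) ∧
        MvPolynomial.homogeneousComponent
            ((w.map (fun l => Matrix.transvection l.1 l.2.1
              (MvPolynomial.C l.2.2.1 * l.2.2.2.elim 1 MvPolynomial.X))).prod i j).totalDegree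
            ((w.map (fun l => Matrix.transvection l.1 l.2.1
              (MvPolynomial.C l.2.2.1 * l.2.2.2.elim 1 MvPolynomial.X))).prod i j)
          = (List.ofFn ℓ).prod

/-- Corollary (Allender–Wang in the transvection model, via Cohn): for `n ≥ 2` no exact affine
E₂-word over `ℂ[x̄]` has an entry equal to `per_n` (its top form `per_n` is irreducible). -/
def NoExactAffineE2WordPer : Prop :=
  ∀ n : ℕ, 2 ≤ n → ∀ (w : List (Fin 2 × Fin 2 × ℂ × Option (Fin n × Fin n))),
    (∀ l ∈ w, l.1 ≠ l.2.1) → ∀ i j : Fin 2,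
      (w.map (fun l => Matrix.transvection l.1 l.2.1
          (MvPolynomial.C l.2.2.1 * l.2.2.2.elim 1 MvPolynomial.X))).prod i j
        ≠ perPoly (Fin n) ℂ

/-- The transfer target C⁺⁺ (junk-free integral border Q-words, BIZ18 Prop. 3.5 shape): there is
no `c` such that for every `n` some product of at most `2^((log₂ n + c)^c)` primitive Q-matrices
`Q(a) = [[a,1],[1,0]]` with `a` a constant of `ℂ(ε) = RatFunc ℂ` or a variable `x_ij` equals
`Q(per_n) + ε·M` with `M ∈ Mat₂(ℂ[ε][x̄])`. -/
def BorderQWordQP : Prop :=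
  ¬ ∃ c : ℕ, ∀ n : ℕ, ∃ w : List (RatFunc ℂ ⊕ (Fin n × Fin n)),
    w.length ≤ 2 ^ ((Nat.log 2 n + c) ^ c) ∧
    ∃ M : Matrix (Fin 2) (Fin 2) (MvPolynomial (Fin n × Fin n) (Polynomial ℂ)),
      (w.map (fun a => (Matrix.of ![![(a.elim MvPolynomial.C MvPolynomial.X :
            MvPolynomial (Fin n × Fin n) (RatFunc ℂ)), 1], ![1, 0]]))).prod
        = Matrix.of ![![MvPolynomial.map (algebraMap ℂ (RatFunc ℂ)) (perPoly (Fin n) ℂ), 1],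
                      ![1, 0]]
          + (MvPolynomial.C (algebraMap (Polynomial ℂ) (RatFunc ℂ) Polynomial.X) :
                MvPolynomial (Fin n × Fin n) (RatFunc ℂ))
              • M.map (MvPolynomial.map (algebraMap (Polynomial ℂ) (RatFunc ℂ)))

/-- The transfer: C⁺⁺ implies the crux (contrapositive: quasi-polynomial E₃-words ⇒ quasi-polynomial
formulas (`WordToFormula`) ⇒ polylog depth (Brent) ⇒ quasi-polynomial junk-free border Q-words
(BIZ18 Prop. 3.5)). To become `stub_transfer` at crux-plan time. -/
def Transfer : Prop :=
  BorderQWordQP → Summit.ValiantsHypothesis.ValiantsHypothesis.Theses.ElementaryWordLength.WordLengthQP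

/-- First border rung (flattenings are border-robust): any junk-free integral border Q-word for
`per_n` has length `r` with `C(n,⌊n/2⌋)² ≤ 2^r`, i.e. `r ≥ 2n - O(log n) > n`: approximants must
overshoot the degree. -/
def BorderOvershoot : Prop :=
  ∀ (n : ℕ) (w : List (RatFunc ℂ ⊕ (Fin n × Fin n)))
    (M : Matrix (Fin 2) (Fin 2) (MvPolynomial (Fin n × Fin n) (Polynomial ℂ))),
      (w.map (fun a => (Matrix.of ![![(a.elim MvPolynomial.C MvPolynomial.X :
            MvPolynomial (Fin n × Fin n) (RatFunc ℂ)), 1], ![1, 0]]))).prod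
        = Matrix.of ![![MvPolynomial.map (algebraMap ℂ (RatFunc ℂ)) (perPoly (Fin n) ℂ), 1],
                      ![1, 0]]
          + (MvPolynomial.C (algebraMap (Polynomial ℂ) (RatFunc ℂ) Polynomial.X) :
                MvPolynomial (Fin n × Fin n) (RatFunc ℂ))
              • M.map (MvPolynomial.map (algebraMap (Polynomial ℂ) (RatFunc ℂ))) →
      (n.choose (n / 2)) ^ 2 ≤ 2 ^ w.length

end Summit.ValiantsHypothesis.ValiantsHypothesis.Cruxes.WordLengthQP.RankOneBorderContinuant
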